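import Mathlib
import Summits.MatrixMultiplication.MatrixMultiplication.Theses.FidelityWitnesses
import Literature.Computability.AlgebraicComplexity.FlatteningBound

/-!
# `FidelityWitnesses.FlatteningWitness` (stmt-MatrixMultiplication-4960) — proved

The support item `FlatteningWitness` of route `MatrixMultiplication/FidelityWitnesses`:
for every `n r : ℕ` and every tensor `S ∈ ℂ^{(n×n)×(n×n)×(n×n)}` of rank `R(S) ≤ r`,

  `‖Σ_{a,b,c} S_{abc} · ⟨n,n,n⟩_{abc}‖² ≤ n · r · Σ_{a,b,c} ‖S_{abc}‖²`,

i.e. the fidelity bound `M(n, r) ≤ n·r` of the flattening (the fidelity form of the classical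
flattening lower bound `R̲(⟨n,n,n⟩) ≥ n²`).

## Proof (elementary flattening argument, no singular values)

Flatten along the first index: the columns `s_{bc} := (a ↦ S_{abc}) ∈ ℂ^{n×n}` of a sum of `R(S)`
triads `w_i ⊗ u_i ⊗ v_i` all lie in `W := span{w_i}`, of dimension `k ≤ R(S) ≤ r`.  Pick an
orthonormal basis `f_1, …, f_k` of `W` (for the standard Hermitian structure of
`EuclideanSpace ℂ (Fin n × Fin n)`), so `s_{bc} = Σ_j ⟪f_j, s_{bc}⟫ f_j` and
`‖s_{bc}‖² = Σ_j |⟪f_j, s_{bc}⟫|²`.  Contracting against `⟨n,n,n⟩` picks, for `b = (κ, μ)`,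
`c = (μ', ν)` with `μ = μ'`, the entry `s_{bc}(κ, ν)`; hence

  `⟨S, ⟨n,n,n⟩⟩ = Σ_{b,c,j} ⟪f_j, s_{bc}⟫ · [b.2 = c.1] f_j(b.1, c.2)`,

and Cauchy–Schwarz over `(b, c, j)` gives
`|⟨S,⟨n,n,n⟩⟩|² ≤ (Σ_{b,c}‖s_{bc}‖²) · Σ_j n‖f_j‖² = ‖S‖² · n · k`
(each coordinate `(κ, ν)` of `f_j` is hit by exactly the `n` pairs with `μ = μ'`).

References: Bläser 2013, §7 (flattenings / slices); Landsberg–Ottaviani 2015 and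
Bürgisser–Clausen–Shokrollahi 1997 (14.8) for the flattening bound it quantifies.
-/

namespace Summit.MatrixMultiplication.MatrixMultiplication.Theorems

open scoped BigOperators InnerProductSpace
open Literature.Computability.AlgebraicComplexity Module

/-- Contraction of a tensor against `⟨n,n,n⟩`: only the entries `S_{(κ,ν),(κ,μ),(μ,ν)}` survive,
written as a sum over the last two indices `b = (κ, μ)`, `c = (μ, ν)`. [folklore] -/
theorem flatteningWitness_contraction (n : ℕ)
    (S : Fin n × Fin n → Fin n × Fin n → Fin n × Fin n → ℂ) :
    ∑ a, ∑ b, ∑ c, S a b c * matMulTensor ℂ n n n a b c =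
      ∑ b, ∑ c, if b.2 = c.1 then S (b.1, c.2) b c else 0 := by
  rw [Finset.sum_comm]
  refine Finset.sum_congr rfl fun b _ => ?_
  rw [Finset.sum_comm]
  refine Finset.sum_congr rfl fun c _ => ?_
  have key : ∀ a : Fin n × Fin n, S a b c * matMulTensor ℂ n n n a b c =
      if a = (b.1, c.2) then (if b.2 = c.1 then S a b c else 0) else 0 := by
    intro a
    unfold matMulTensor
    by_cases h1 : a = (b.1, c.2)
    · subst h1
      by_cases h2 : b.2 = c.1 <;> simp [h2]
    · have h1' : ¬ (a.1 = b.1 ∧ b.2 = c.1 ∧ a.2 = c.2) := by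
        rintro ⟨e1, -, e3⟩
        exact h1 (Prod.ext e1 e3)
      rw [if_neg h1', if_neg h1, mul_zero]
  simp_rw [key]
  rw [Finset.sum_ite_eq' Finset.univ (b.1, c.2)]
  simp

/-- The counting identity behind `T_flat T_flat* = n·I`: each coordinate `(κ, ν)` is hit by exactly
the `n` index pairs `b = (κ, μ)`, `c = (μ, ν)`. [folklore] -/
theorem flatteningWitness_count (n : ℕ) (g : Fin n × Fin n → ℝ) :
    ∑ b : Fin n × Fin n, ∑ c : Fin n × Fin n, (if b.2 = c.1 then g (b.1, c.2) else 0) =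
      (n : ℝ) * ∑ a, g a := by
  rw [Fintype.sum_prod_type, Fintype.sum_prod_type, Finset.mul_sum]
  refine Finset.sum_congr rfl fun κ _ => ?_
  have inner : ∀ μ : Fin n, ∑ c : Fin n × Fin n, (if (κ, μ).2 = c.1 then g ((κ, μ).1, c.2) else 0)
      = ∑ ν, g (κ, ν) := by
    intro μ
    rw [Fintype.sum_prod_type, Finset.sum_comm]
    refine Finset.sum_congr rfl fun ν _ => ?_
    rw [Finset.sum_ite_eq Finset.univ μ]
    simp
  simp_rw [inner]
  rw [Finset.sum_const, Finset.card_univ, Fintype.card_fin, nsmul_eq_mul]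

/-- **`FlatteningWitness`** (item `stmt-MatrixMultiplication-4960`): for `R(S) ≤ r`,
`‖⟨S, ⟨n,n,n⟩⟩‖² ≤ n · r · ‖S‖²` — the fidelity form `M(n,r) ≤ n·r` of the flattening bound.
[folklore] -/
theorem flatteningWitness_proof :
    Summit.MatrixMultiplication.MatrixMultiplication.Theses.FidelityWitnesses.FlatteningWitness := by
  unfold Summit.MatrixMultiplication.MatrixMultiplication.Theses.FidelityWitnesses.FlatteningWitness
  intro n r S hS
  classical
  -- a shortest decomposition of `S` into triads, entrywise
  obtain ⟨w, u, v, hdec⟩ := exists_triad_decomposition_tensorRank S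
  have hSabc : ∀ a b c, S a b c = ∑ i, w i a * u i b * v i c := by
    intro a b c
    have h := congrFun (congrFun (congrFun hdec a) b) c
    rw [h]
    simp only [Finset.sum_apply, triad_apply]
  -- the flattening: columns of `S` as vectors of the Hermitian space `ℂ^{n×n}`
  let col : Fin n × Fin n → Fin n × Fin n → EuclideanSpace ℂ (Fin n × Fin n) :=
    fun b c => WithLp.toLp 2 (fun a => S a b c)
  let wv : Fin (tensorRank S) → EuclideanSpace ℂ (Fin n × Fin n) := fun i => WithLp.toLp 2 (w i)
  let W : Submodule ℂ (EuclideanSpace ℂ (Fin n × Fin n)) := Submodule.span ℂ (Set.range wv)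
  have hcolW : ∀ b c, col b c ∈ W := by
    intro b c
    have hc : col b c = ∑ i, (u i b * v i c) • wv i := by
      refine PiLp.ext fun a => ?_
      simp only [col, wv, WithLp.ofLp_sum, WithLp.ofLp_smul, Finset.sum_apply, Pi.smul_apply,
        smul_eq_mul]
      rw [hSabc]
      exact Finset.sum_congr rfl fun i _ => by ring
    rw [hc]
    exact Submodule.sum_mem _ fun i _ => Submodule.smul_mem _ _ (Submodule.subset_span ⟨i, rfl⟩)
  -- `dim W ≤ R(S) ≤ r`
  have hk : finrank ℂ W ≤ r :=
    ((finrank_range_le_card wv).trans (by rw [Fintype.card_fin])).trans hS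
  -- an orthonormal basis of `W`
  set k := finrank ℂ W with hkdef
  let ob : OrthonormalBasis (Fin k) ℂ W := stdOrthonormalBasis ℂ W
  let f : Fin k → EuclideanSpace ℂ (Fin n × Fin n) := fun j => (ob j : EuclideanSpace ℂ _)
  let coef : Fin k → Fin n × Fin n → Fin n × Fin n → ℂ := fun j b c => ⟪f j, col b c⟫_ℂ
  -- expansion of each column in the basis, coordinatewise
  have hexp : ∀ b c a, S a b c = ∑ j, coef j b c * f j a := by
    intro b c a
    have hx := ob.sum_repr' ⟨col b c, hcolW b c⟩
    have hx' := congrArg (fun x : W => (x : EuclideanSpace ℂ (Fin n × Fin n)) a) hx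
    simp only [Submodule.coe_sum, Submodule.coe_smul, WithLp.ofLp_sum, WithLp.ofLp_smul,
      Finset.sum_apply, Pi.smul_apply, smul_eq_mul, Submodule.coe_inner] at hx'
    simpa [col] using hx'.symm
  -- Parseval for each column
  have hpars : ∀ b c, ∑ j, ‖coef j b c‖ ^ 2 = ∑ a, ‖S a b c‖ ^ 2 := by
    intro b c
    have h1 : ‖ob.repr ⟨col b c, hcolW b c⟩‖ = ‖(⟨col b c, hcolW b c⟩ : W)‖ := ob.repr.norm_map _
    have h2 : ‖ob.repr ⟨col b c, hcolW b c⟩‖ ^ 2 = ‖(⟨col b c, hcolW b c⟩ : W)‖ ^ 2 := by rw [h1]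
    rw [EuclideanSpace.norm_sq_eq, Submodule.coe_norm, EuclideanSpace.norm_sq_eq] at h2
    simp only [ob.repr_apply_apply, Submodule.coe_inner] at h2
    simpa [col] using h2
  -- each basis vector has unit norm
  have hunit : ∀ j, ∑ a, ‖f j a‖ ^ 2 = 1 := by
    intro j
    have h1 : ‖f j‖ = 1 := by
      change ‖(ob j : EuclideanSpace ℂ (Fin n × Fin n))‖ = 1
      rw [Submodule.norm_coe]
      exact ob.orthonormal.1 j
    rw [← EuclideanSpace.norm_sq_eq, h1, one_pow]
  -- the contraction as a single sum over `p = (b, (c, j))`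
  let X : (Fin n × Fin n) × (Fin n × Fin n) × Fin k → ℂ := fun p => coef p.2.2 p.1 p.2.1
  let Y : (Fin n × Fin n) × (Fin n × Fin n) × Fin k → ℂ :=
    fun p => if p.1.2 = p.2.1.1 then f p.2.2 (p.1.1, p.2.1.2) else 0
  have hip : ∑ a, ∑ b, ∑ c, S a b c * matMulTensor ℂ n n n a b c = ∑ p, X p * Y p := by
    rw [flatteningWitness_contraction, Fintype.sum_prod_type (f := fun p => X p * Y p)]
    refine Finset.sum_congr rfl fun b _ => ?_
    rw [Fintype.sum_prod_type (f := fun q : (Fin n × Fin n) × Fin k => X (b, q) * Y (b, q))]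
    refine Finset.sum_congr rfl fun c _ => ?_
    simp only [X, Y]
    split_ifs with h
    · rw [hexp b c (b.1, c.2)]
    · simp
  -- Cauchy–Schwarz
  have hCS : ‖∑ p, X p * Y p‖ ^ 2 ≤ (∑ p, ‖X p‖ ^ 2) * ∑ p, ‖Y p‖ ^ 2 := by
    have h1 : ‖∑ p, X p * Y p‖ ≤ ∑ p, ‖X p‖ * ‖Y p‖ :=
      (norm_sum_le _ _).trans (le_of_eq (Finset.sum_congr rfl fun p _ => norm_mul _ _))
    calc ‖∑ p, X p * Y p‖ ^ 2 ≤ (∑ p, ‖X p‖ * ‖Y p‖) ^ 2 :=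
          pow_le_pow_left₀ (norm_nonneg _) h1 2
      _ ≤ (∑ p, ‖X p‖ ^ 2) * ∑ p, ‖Y p‖ ^ 2 := Finset.sum_mul_sq_le_sq_mul_sq _ _ _
  -- `Σ ‖X‖² = ‖S‖²`
  have hX : ∑ p, ‖X p‖ ^ 2 = ∑ a, ∑ b, ∑ c, ‖S a b c‖ ^ 2 := by
    have e : ∑ p, ‖X p‖ ^ 2 =
        ∑ b : Fin n × Fin n, ∑ c : Fin n × Fin n, ∑ j : Fin k, ‖coef j b c‖ ^ 2 := by
      rw [Fintype.sum_prod_type (f := fun p => ‖X p‖ ^ 2)]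
      refine Finset.sum_congr rfl fun b _ => ?_
      rw [Fintype.sum_prod_type (f := fun q : (Fin n × Fin n) × Fin k => ‖X (b, q)‖ ^ 2)]
    rw [e]
    simp_rw [hpars]
    symm
    rw [Finset.sum_comm]
    refine Finset.sum_congr rfl fun b _ => ?_
    rw [Finset.sum_comm]
  -- `Σ ‖Y‖² = n · k`
  have hY : ∑ p, ‖Y p‖ ^ 2 = (n : ℝ) * k := by
    have e : ∑ p, ‖Y p‖ ^ 2 = ∑ b : Fin n × Fin n, ∑ c : Fin n × Fin n, ∑ j : Fin k,
        ‖(if b.2 = c.1 then f j (b.1, c.2) else 0 : ℂ)‖ ^ 2 := by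
      rw [Fintype.sum_prod_type (f := fun p => ‖Y p‖ ^ 2)]
      refine Finset.sum_congr rfl fun b _ => ?_
      rw [Fintype.sum_prod_type (f := fun q : (Fin n × Fin n) × Fin k => ‖Y (b, q)‖ ^ 2)]
    have hswap : ∑ b : Fin n × Fin n, ∑ c : Fin n × Fin n, ∑ j : Fin k,
        ‖(if b.2 = c.1 then f j (b.1, c.2) else 0 : ℂ)‖ ^ 2 =
        ∑ j : Fin k, ∑ b : Fin n × Fin n, ∑ c : Fin n × Fin n,
          (if b.2 = c.1 then ‖f j (b.1, c.2)‖ ^ 2 else 0) := by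
      symm
      rw [Finset.sum_comm]
      refine Finset.sum_congr rfl fun b _ => ?_
      rw [Finset.sum_comm]
      refine Finset.sum_congr rfl fun c _ => Finset.sum_congr rfl fun j _ => ?_
      split_ifs <;> simp
    have hj : ∀ j : Fin k, ∑ b : Fin n × Fin n, ∑ c : Fin n × Fin n,
        (if b.2 = c.1 then ‖f j (b.1, c.2)‖ ^ 2 else 0) = (n : ℝ) := by
      intro j
      have hc := flatteningWitness_count n (fun a => ‖f j a‖ ^ 2)
      simp only [hunit, mul_one] at hc
      exact hc
    rw [e, hswap, Finset.sum_congr rfl fun j _ => hj j, Finset.sum_const, Finset.card_univ,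
      Fintype.card_fin, nsmul_eq_mul, mul_comm]
  -- assemble
  have hnormS : 0 ≤ ∑ a, ∑ b, ∑ c, ‖S a b c‖ ^ 2 :=
    Finset.sum_nonneg fun a _ => Finset.sum_nonneg fun b _ =>
      Finset.sum_nonneg fun c _ => by positivity
  have hkr : (k : ℝ) ≤ r := by exact_mod_cast hk
  calc ‖∑ a, ∑ b, ∑ c, S a b c * matMulTensor ℂ n n n a b c‖ ^ 2
      = ‖∑ p, X p * Y p‖ ^ 2 := by rw [hip]
    _ ≤ (∑ p, ‖X p‖ ^ 2) * ∑ p, ‖Y p‖ ^ 2 := hCS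
    _ = (∑ a, ∑ b, ∑ c, ‖S a b c‖ ^ 2) * ((n : ℝ) * k) := by rw [hX, hY]
    _ ≤ (∑ a, ∑ b, ∑ c, ‖S a b c‖ ^ 2) * ((n : ℝ) * r) := by gcongr
    _ = (n : ℝ) * (r : ℝ) * ∑ a, ∑ b, ∑ c, ‖S a b c‖ ^ 2 := by ring

end Summit.MatrixMultiplication.MatrixMultiplication.Theorems
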